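import Summits.ABC.StewartYu.PrimePadicSocketTools
import HarnessLib

/-!
# Cell abc-stewartyu: the prime-argument `p`-adic SOCKET of the abc assembly, II —
# book-keeping of the logarithmic factor and of the powers of the radical

`Summits/ABC/StewartYu/PrimePadicSocketLog.lean` — sequel to
`PrimePadicSocketTools.lean` (theorems only: no definition, no named fact).
Elementary inequalities used by `sum_padicPart_le_rad_general` (next file) to absorb the
logarithmic factor `(W + log R)^{τ₀ + τ₁ n}` of a crude `p`-adic bound against the radical, where
`n = ω(yz)`, `n! ≤ Q = rad(yz)`, `R = rad(xyz) ≥ 1`, `W = log Y₃ ≥ 1`: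
`(1 + log R)^{τ₁ n} ≤ (eQR)^{τ₁}` (`one_add_log_pow_mul_le`),
`(1 + log R)^{τ₀} ≤ (8(τ₀+1))^{τ₀} · 2R^{1/8}` (`one_add_log_pow_le`),
`W^{τ₁ n} ≤ ((τ₁+1)/δ)^{τ₁ n} Q^{τ₁} Y₃^δ` (`log_pow_mul_le`), their product (`logFactor_le`), and
the collection of the powers `R^κ R^{1/4} R^{1/8} R^{τ₁} R^{1/8} R^{τ₁} R^{τ₁} (R^σ R^{1/8}) =
R^{κ+σ+3τ₁+5/8}` (`rpow_collect`, `powers_le_rpow`). All [folklore]; nothing here is in print.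
-/



noncomputable section

open Finset Real
open Literature.NumberTheory.DiophantineGeometry

namespace Summit.ABC.StewartYu

open Literature.Barriers.ABC Literature.Barriers.ABC.StewartTijdemanGeneric

/-! ### Book-keeping lemmas for the general socket -/

/-- `(1 + log R)^{τ n} ≤ (e Q R)^τ` when `n! ≤ Q` and `R ≥ 1` (`(1 + log R)ⁿ ≤ n! · e^{1 + log R}`).
[folklore] -/
theorem one_add_log_pow_mul_le {Q R : ℝ} {n τ : ℕ} (hR : 1 ≤ R) (hfact : (n.factorial : ℝ) ≤ Q) :
    (1 + Real.log R) ^ (τ * n) ≤ (Real.exp 1 * Q * R) ^ τ := by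
  have hR0 : 0 < R := by linarith
  have hlog : 0 ≤ Real.log R := Real.log_nonneg hR
  have hexpR : Real.exp (1 + Real.log R) = Real.exp 1 * R := by
    rw [Real.exp_add, Real.exp_log hR0]
  have hQ0 : 0 ≤ Q := le_trans (Nat.cast_nonneg _) hfact
  rw [mul_comm τ n, pow_mul]
  apply pow_le_pow_left₀ (pow_nonneg (by linarith) n)
  calc (1 + Real.log R) ^ n ≤ (n.factorial : ℝ) * Real.exp (1 + Real.log R) := by
        -- one term of the exponential series
        have h0 := Real.pow_div_factorial_le_exp (1 + Real.log R) (by linarith) n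
        have hf : (0 : ℝ) < n.factorial := by exact_mod_cast Nat.factorial_pos n
        rw [div_le_iff₀ hf] at h0
        linarith [h0]
    _ ≤ Q * (Real.exp 1 * R) := by
        rw [hexpR]
        exact mul_le_mul_of_nonneg_right hfact (by positivity)
    _ = Real.exp 1 * Q * R := by ring

/-- `(1 + log R)^τ ≤ (8(τ+1))^τ · 2 R^{1/8}` for `R ≥ 1` (`log(eR) ≤ 8(τ+1) (eR)^{1/(8(τ+1))}`,
`e^{1/8} ≤ 2`). [folklore] -/
theorem one_add_log_pow_le {R : ℝ} (hR : 1 ≤ R) (τ : ℕ) :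
    (1 + Real.log R) ^ τ ≤ (8 * ((τ : ℝ) + 1)) ^ τ * (2 * R ^ (1 / 8 : ℝ)) := by
  have hR0 : 0 < R := by linarith
  have heR1 : 1 ≤ Real.exp 1 * R :=
    one_le_mul_of_one_le_of_one_le (by linarith [Real.exp_one_gt_d9]) hR
  have h := log_pow_le_mul_rpow (δ := 1 / 8) (by norm_num) τ heR1
  rw [Real.log_mul (Real.exp_pos 1).ne' hR0.ne', Real.log_exp] at h
  have hc : ((τ : ℝ) + 1) / (1 / 8) = 8 * ((τ : ℝ) + 1) := by ring
  rw [hc] at h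
  refine h.trans (mul_le_mul_of_nonneg_left ?_ (pow_nonneg (by positivity) τ))
  rw [Real.mul_rpow (Real.exp_pos 1).le hR0.le]
  apply mul_le_mul_of_nonneg_right _ (Real.rpow_nonneg hR0.le _)
  have he256 : Real.exp 1 ≤ (2 : ℝ) ^ (8 : ℕ) := le_trans Real.exp_one_lt_d9.le (by norm_num)
  have h18 : (1 / 8 : ℝ) = ((8 : ℕ) : ℝ)⁻¹ := by norm_num
  calc Real.exp 1 ^ (1 / 8 : ℝ) ≤ ((2 : ℝ) ^ (8 : ℕ)) ^ (1 / 8 : ℝ) :=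
        Real.rpow_le_rpow (Real.exp_pos 1).le he256 (by norm_num)
    _ = 2 := by rw [h18, Real.pow_rpow_inv_natCast (by norm_num) (by norm_num)]

/-- `W^{τ n} ≤ ((τ+1)/δ)^{τ n} · Q^τ · Y^δ` for `W = log Y`, `Y ≥ 1`, `n! ≤ Q`, `δ > 0`
(`Wⁿ ≤ ε^{-n} n! e^{εW}` with `ε = δ/(τ+1)`, and `τ ε ≤ δ`). [folklore] -/
theorem log_pow_mul_le {Q Y δ : ℝ} {n τ : ℕ} (hY : 1 ≤ Y) (hfact : (n.factorial : ℝ) ≤ Q)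
    (hδ : 0 < δ) :
    Real.log Y ^ (τ * n) ≤ (((τ : ℝ) + 1) / δ) ^ (τ * n) * Q ^ τ * Y ^ δ := by
  have hY0 : 0 < Y := by linarith
  have hW0 : 0 ≤ Real.log Y := Real.log_nonneg hY
  have hfact0 : (0 : ℝ) ≤ (n.factorial : ℝ) := Nat.cast_nonneg _
  have hQ0 : 0 ≤ Q := hfact0.trans hfact
  set ε : ℝ := δ / ((τ : ℝ) + 1) with hε
  have hτ1 : (0 : ℝ) < (τ : ℝ) + 1 := by positivity
  have hε0 : 0 < ε := by rw [hε]; positivity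
  have hτε : (τ : ℝ) * ε ≤ δ := by
    rw [hε, mul_div_assoc', div_le_iff₀ hτ1]
    have := mul_le_mul_of_nonneg_left (show (τ : ℝ) ≤ τ + 1 by linarith) hδ.le
    linarith [mul_comm (τ : ℝ) δ]
  rw [mul_comm τ n, pow_mul, pow_mul]
  have hstep : Real.log Y ^ n ≤ (1 / ε) ^ n * (n.factorial : ℝ) * Real.exp (ε * Real.log Y) :=
    pow_le_pow_mul_factorial_mul_exp hε0 hW0 n
  have h1ε : 1 / ε = ((τ : ℝ) + 1) / δ := by rw [hε]; field_simp
  rw [h1ε] at hstep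
  have hc0 : 0 ≤ ((((τ : ℝ) + 1) / δ) ^ n) ^ τ := pow_nonneg (pow_nonneg (by positivity) n) τ
  have hfτ : ((n.factorial : ℝ)) ^ τ ≤ Q ^ τ := pow_le_pow_left₀ hfact0 hfact τ
  have hexp : Real.exp (ε * Real.log Y) ^ τ ≤ Y ^ δ := by
    rw [← Real.exp_nat_mul, Real.rpow_def_of_pos hY0,
      show (τ : ℝ) * (ε * Real.log Y) = (τ * ε) * Real.log Y by ring, mul_comm (Real.log Y)]
    exact Real.exp_le_exp.mpr (mul_le_mul_of_nonneg_right hτε hW0)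
  calc (Real.log Y ^ n) ^ τ
      ≤ ((((τ : ℝ) + 1) / δ) ^ n * (n.factorial : ℝ) * Real.exp (ε * Real.log Y)) ^ τ :=
        pow_le_pow_left₀ (pow_nonneg hW0 n) hstep τ
    _ = ((((τ : ℝ) + 1) / δ) ^ n) ^ τ * ((n.factorial : ℝ)) ^ τ *
          Real.exp (ε * Real.log Y) ^ τ := by rw [mul_pow, mul_pow]
    _ ≤ ((((τ : ℝ) + 1) / δ) ^ n) ^ τ * Q ^ τ * Real.exp (ε * Real.log Y) ^ τ :=
        mul_le_mul_of_nonneg_right (mul_le_mul_of_nonneg_left hfτ hc0)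
          (pow_nonneg (Real.exp_pos _).le τ)
    _ ≤ ((((τ : ℝ) + 1) / δ) ^ n) ^ τ * Q ^ τ * Y ^ δ :=
        mul_le_mul_of_nonneg_left hexp (mul_nonneg hc0 (pow_nonneg hQ0 τ))

/-- The logarithmic factor of the general socket against the radical: with `W₃ = log Y₃ ≥ 1`,
`W₃ ≤ 2W`, `R ≥ 1`, `n! ≤ Q`:
`(W₃ + log R)^{τ₀ + τ₁ n} ≤ (2^{τ₀} W^{τ₀}) (C^{τ₁ n} Q^{τ₁} Y₃^δ) ((8(τ₀+1))^{τ₀} 2R^{1/8}) (eQR)^{τ₁}`,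
`C = (τ₁+1)/δ`. [folklore] -/
theorem logFactor_le {Q R Y₃ W δ : ℝ} {n τ₀ τ₁ : ℕ} (hR : 1 ≤ R) (hY₃ : 1 ≤ Y₃)
    (hW₃1 : 1 ≤ Real.log Y₃) (hW₃W : Real.log Y₃ ≤ 2 * W) (hfact : (n.factorial : ℝ) ≤ Q)
    (hδ : 0 < δ) :
    (Real.log Y₃ + Real.log R) ^ (τ₀ + τ₁ * n) ≤
      (2 ^ τ₀ * W ^ τ₀) * ((((τ₁ : ℝ) + 1) / δ) ^ (τ₁ * n) * Q ^ τ₁ * Y₃ ^ δ) *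
        ((8 * ((τ₀ : ℝ) + 1)) ^ τ₀ * (2 * R ^ (1 / 8 : ℝ))) * (Real.exp 1 * Q * R) ^ τ₁ := by
  have hR0 : 0 < R := by linarith
  have hlogR0 : 0 ≤ Real.log R := Real.log_nonneg hR
  have hW₃0 : 0 ≤ Real.log Y₃ := zero_le_one.trans hW₃1
  have hQ0 : 0 ≤ Q := le_trans (Nat.cast_nonneg _) hfact
  have hW0 : 0 ≤ W := by linarith
  have hY₃0 : 0 ≤ Y₃ := by linarith
  set W₃ := Real.log Y₃ with hW₃
  -- `(W₃ + log R)^N ≤ W₃^N (1 + log R)^N`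
  have h4 : (W₃ + Real.log R) ^ (τ₀ + τ₁ * n) ≤
      W₃ ^ (τ₀ + τ₁ * n) * (1 + Real.log R) ^ (τ₀ + τ₁ * n) := by
    rw [← mul_pow]
    apply pow_le_pow_left₀ (by linarith)
    have : Real.log R ≤ W₃ * Real.log R := le_mul_of_one_le_left hlogR0 hW₃1
    linarith [mul_add W₃ 1 (Real.log R)]
  have h4a := one_add_log_pow_mul_le (τ := τ₁) hR hfact
  have h4b := one_add_log_pow_le hR τ₀
  have h4c := log_pow_mul_le (τ := τ₁) hY₃ hfact hδ
  have h4d : W₃ ^ τ₀ ≤ 2 ^ τ₀ * W ^ τ₀ := by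
    rw [← mul_pow]; exact pow_le_pow_left₀ hW₃0 hW₃W τ₀
  calc (W₃ + Real.log R) ^ (τ₀ + τ₁ * n)
      ≤ W₃ ^ (τ₀ + τ₁ * n) * (1 + Real.log R) ^ (τ₀ + τ₁ * n) := h4
    _ = (W₃ ^ τ₀ * W₃ ^ (τ₁ * n)) * ((1 + Real.log R) ^ τ₀ * (1 + Real.log R) ^ (τ₁ * n)) := by
        rw [pow_add, pow_add]
    _ ≤ ((2 ^ τ₀ * W ^ τ₀) * ((((τ₁ : ℝ) + 1) / δ) ^ (τ₁ * n) * Q ^ τ₁ * Y₃ ^ δ)) *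
          (((8 * ((τ₀ : ℝ) + 1)) ^ τ₀ * (2 * R ^ (1 / 8 : ℝ))) * (Real.exp 1 * Q * R) ^ τ₁) := by
        apply mul_le_mul
        · exact mul_le_mul h4d h4c (pow_nonneg hW₃0 _) (by positivity)
        · exact mul_le_mul h4b h4a (pow_nonneg (by linarith) _) (by positivity)
        · exact mul_nonneg (pow_nonneg (by linarith) _) (pow_nonneg (by linarith) _)
        · positivity
    _ = _ := by ring

/-- Collecting the powers of the radical: for `R > 0`,
`R^κ R^{1/4} R^{1/8} R^{τ} R^{1/8} R^{τ} R^{τ} (R^σ R^{1/8}) = R^{κ+σ+3τ+5/8}`. [folklore] -/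
theorem rpow_collect {R κ σ : ℝ} (hR0 : 0 < R) (τ : ℕ) :
    R ^ κ * R ^ (1 / 4 : ℝ) * R ^ (1 / 8 : ℝ) * R ^ τ * R ^ (1 / 8 : ℝ) * R ^ τ * R ^ τ *
      (R ^ σ * R ^ (1 / 8 : ℝ)) = R ^ (κ + σ + 3 * τ + 5 / 8 : ℝ) := by
  rw [← Real.rpow_natCast R τ]
  simp only [← Real.rpow_add hR0]
  congr 1; ring

/-- Monotonicity of the collected powers: `0 < Q ≤ R`, `0 < P ≤ R`, `κ, σ ≥ 0`. [folklore] -/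
theorem powers_le_rpow {Q P R κ σ : ℝ} (hQ0 : 0 < Q) (hQR : Q ≤ R) (hP0 : 0 < P) (hPR : P ≤ R)
    (hκ : 0 ≤ κ) (hσ : 0 ≤ σ) (τ : ℕ) :
    Q ^ κ * Q ^ (1 / 4 : ℝ) * Q ^ (1 / 8 : ℝ) * Q ^ τ * R ^ (1 / 8 : ℝ) * Q ^ τ * R ^ τ *
      (P ^ σ * P ^ (1 / 8 : ℝ)) ≤ R ^ (κ + σ + 3 * τ + 5 / 8 : ℝ) := by
  have hR0 : 0 < R := lt_of_lt_of_le hQ0 hQR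
  rw [← rpow_collect hR0 τ]
  have hQκ : Q ^ κ ≤ R ^ κ := Real.rpow_le_rpow hQ0.le hQR hκ
  have hQ4 : Q ^ (1 / 4 : ℝ) ≤ R ^ (1 / 4 : ℝ) := Real.rpow_le_rpow hQ0.le hQR (by norm_num)
  have hQ8 : Q ^ (1 / 8 : ℝ) ≤ R ^ (1 / 8 : ℝ) := Real.rpow_le_rpow hQ0.le hQR (by norm_num)
  have hQτ : Q ^ τ ≤ R ^ τ := pow_le_pow_left₀ hQ0.le hQR τ
  have hPσ : P ^ σ * P ^ (1 / 8 : ℝ) ≤ R ^ σ * R ^ (1 / 8 : ℝ) :=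
    mul_le_mul (Real.rpow_le_rpow hP0.le hPR hσ) (Real.rpow_le_rpow hP0.le hPR (by norm_num))
      (Real.rpow_nonneg hP0.le _) (Real.rpow_nonneg hR0.le _)
  have hR8 : 0 ≤ R ^ (1 / 8 : ℝ) := Real.rpow_nonneg hR0.le _
  have hRτ : 0 ≤ R ^ τ := pow_nonneg hR0.le _
  apply mul_le_mul _ hPσ (by positivity) (by positivity)
  apply mul_le_mul_of_nonneg_right _ hRτ
  apply mul_le_mul _ hQτ (by positivity) (by positivity)
  apply mul_le_mul_of_nonneg_right _ hR8
  apply mul_le_mul _ hQτ (by positivity) (by positivity)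
  apply mul_le_mul _ hQ8 (by positivity) (by positivity)
  exact mul_le_mul hQκ hQ4 (by positivity) (by positivity)

end Summit.ABC.StewartYu

end
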